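import Summits.Ventures.Crystal3D.Theorems.StickyWulffConstantGenericWallFloorSlotTriples
import Summits.Ventures.Crystal3D.Theorems.StickyWulffConstantGenericWallFloorDozenRigidity
import Summits.Ventures.Crystal3D.Theorems.StickyWulffConstantGenericWallFloorSharedTriangle
import HarnessLib

/-!
# A grain chain cannot run through the foreign plate: up-slots landing on a lattice pin the frame
# (crux `GenericWallFloor`, line `WallLedgerG`; chain ledger §81(3) / lines floor terminal step)

HONEST FRAMING. Part of the venture `Summits/Ventures/Crystal3D` (cell `crystal3d-full`), helper
`--supports` the crux `GenericWallFloor` (stmt-Ventures-19480), registered line `WallLedgerG`, open stub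
`stub_twoSlabAdhesion`.  cf-p1 ROUTE §81(3) (TC ledger): «a chain can never run THROUGH the complete
foreign plate P₂: a covered X₁-ball inside P₂'s slab would put its up-sites exactly on Λ₂ sites, and 3
independent common difference vectors force A₁Λ₀ + t₁ = A₂Λ₀ + t₂ locally ⇒ excluded»; 19480-p1
LINES-FLOOR-ARCH v3: «lines cannot exit through the P₂ window: three independent exact F-slots on Λ₂ pin
F(Λ₀) = A₂(Λ₀)».  Here as theorems (from `movedFcc_eq_of_three_independent_slots`, …DozenRigidity, and the
hemisphere lemma, …SlotTriples):

* `linear_eq_of_slots_on_affine` — `b`, `b + F wᵢ` on `A₂·Λ₀ + t₂` for three independent slots ⇒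
  `F·Λ₀ = A₂·Λ₀`;  `linear_eq_of_upSlots_on_affine` — the same from all up-slots `⟪F w, ν⟫ > 0`;
* **`not_covered_on_foreign_plate`** — non-co-axial pair, `F = A₁`: impossible (`coaxial_of_image_eq`);
* `frame_eq_foreign_of_covered` — general frame `F`: `F` is then co-axial with `A₂`.

WHAT THIS IS NOT: the slab-completeness step «ball inside a complete lattice slab is a lattice ball» is the
landed sealing (`…GenericWallFloorSealing` / `…SlabSealing`), not repeated here; rung F-C1 not moved.
-/

noncomputable section

namespace Summit.Ventures.Crystal3D.Theorems

open Finset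
open Literature.MathematicalPhysics.StatisticalMechanics (fccStacking barlowStacking IsHaggSeq)
open scoped InnerProductSpace

/-- **Three independent slots landing on a lattice pin the frame.**  If `b` and `b + F w₁, b + F w₂,
b + F w₃` (with `w₁, w₂, w₃` linearly independent slots) all lie on the moved lattice `A₂·Λ₀ + t₂`, then
`F·Λ₀ = A₂·Λ₀` as linear lattices. -/
theorem linear_eq_of_slots_on_affine
    (F A₂ : EuclideanSpace ℝ (Fin 3) ≃ₗᵢ[ℝ] EuclideanSpace ℝ (Fin 3)) (t₂ : EuclideanSpace ℝ (Fin 3))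
    {b : EuclideanSpace ℝ (Fin 3)} (hb : b ∈ (fun p => A₂ p + t₂) '' fccStacking 1 (Real.sqrt (2 / 3)))
    {w₁ w₂ w₃ : EuclideanSpace ℝ (Fin 3)} (hw₁ : w₁ ∈ fccSlots) (hw₂ : w₂ ∈ fccSlots) (hw₃ : w₃ ∈ fccSlots)
    (h₁ : b + F w₁ ∈ (fun p => A₂ p + t₂) '' fccStacking 1 (Real.sqrt (2 / 3)))
    (h₂ : b + F w₂ ∈ (fun p => A₂ p + t₂) '' fccStacking 1 (Real.sqrt (2 / 3)))
    (h₃ : b + F w₃ ∈ (fun p => A₂ p + t₂) '' fccStacking 1 (Real.sqrt (2 / 3)))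
    (hind : LinearIndependent ℝ ![w₁, w₂, w₃]) :
    F '' fccStacking 1 (Real.sqrt (2 / 3)) = A₂ '' fccStacking 1 (Real.sqrt (2 / 3)) := by
  have d : ∀ {w}, b + F w ∈ (fun p => A₂ p + t₂) '' fccStacking 1 (Real.sqrt (2 / 3)) →
      F w ∈ A₂ '' fccStacking 1 (Real.sqrt (2 / 3)) := by
    intro w hw
    have := sub_mem_image_of_mem_affine A₂ t₂ _ _ hw hb
    rwa [add_sub_cancel_left] at this
  exact movedFcc_eq_of_three_independent_slots F A₂ hw₁ hw₂ hw₃ (d h₁) (d h₂) (d h₃) hind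

/-- **Up-slots landing on a lattice pin the frame** (hemisphere form): if `b` and all `b + F w` with
`⟪F w, ν⟫ > 0` (`ν ≠ 0`) lie on `A₂·Λ₀ + t₂`, then `F·Λ₀ = A₂·Λ₀`. -/
theorem linear_eq_of_upSlots_on_affine
    (F A₂ : EuclideanSpace ℝ (Fin 3) ≃ₗᵢ[ℝ] EuclideanSpace ℝ (Fin 3)) (t₂ : EuclideanSpace ℝ (Fin 3))
    {ν : EuclideanSpace ℝ (Fin 3)} (hν : ν ≠ 0)
    {b : EuclideanSpace ℝ (Fin 3)} (hb : b ∈ (fun p => A₂ p + t₂) '' fccStacking 1 (Real.sqrt (2 / 3)))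
    (hup : ∀ w ∈ fccSlots, 0 < ⟪F w, ν⟫_ℝ → b + F w ∈ (fun p => A₂ p + t₂) '' fccStacking 1 (Real.sqrt (2 / 3))) :
    F '' fccStacking 1 (Real.sqrt (2 / 3)) = A₂ '' fccStacking 1 (Real.sqrt (2 / 3)) := by
  have hν' : -ν ≠ 0 := neg_ne_zero.2 hν
  obtain ⟨w₁, hw₁, w₂, hw₂, w₃, hw₃, h₁, h₂, h₃, hind⟩ := exists_independent_slots_of_hemisphere F hν'
  have pos : ∀ {w}, ⟪F w, -ν⟫_ℝ < 0 → 0 < ⟪F w, ν⟫_ℝ := fun h => by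
    rw [inner_neg_right] at h; linarith
  exact linear_eq_of_slots_on_affine F A₂ t₂ hb hw₁ hw₂ hw₃ (hup w₁ hw₁ (pos h₁)) (hup w₂ hw₂ (pos h₂))
    (hup w₃ hw₃ (pos h₃)) hind

/-- **A chain of grain 1 cannot be covered inside the foreign plate** (cf-p1 ROUTE §81(3): «a chain can
never run THROUGH the complete foreign plate P₂»; 19480-p1's terminal step for `F = A₁`).  For a
NON-co-axial pair: if a ball `b` on `A₂·Λ₀ + t₂` had all its up-slots `b + A₁ w` (`⟪A₁ w, ν⟫ > 0`) on
`A₂·Λ₀ + t₂` as well — which is what completeness of `P₂` forces for a covered grain-1 chain ball inside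
the `P₂` slab — then `A₁·Λ₀ = A₂·Λ₀` and the pair would be co-axial. -/
theorem not_covered_on_foreign_plate
    (A₁ A₂ : EuclideanSpace ℝ (Fin 3) ≃ₗᵢ[ℝ] EuclideanSpace ℝ (Fin 3)) (t₁ t₂ : EuclideanSpace ℝ (Fin 3))
    (hnc : ¬ ∃ (L' : EuclideanSpace ℝ (Fin 3) ≃ₗᵢ[ℝ] EuclideanSpace ℝ (Fin 3))
      (s₁ s₂ : EuclideanSpace ℝ (Fin 3)) (σ σ' : ℤ → ℤ), IsHaggSeq σ ∧ IsHaggSeq σ' ∧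
      (fun p => A₁ p + t₁) '' fccStacking 1 (Real.sqrt (2 / 3)) ⊆
        (fun p => L' p + s₁) '' barlowStacking 1 (Real.sqrt (2 / 3)) σ ∧
      (fun p => A₂ p + t₂) '' fccStacking 1 (Real.sqrt (2 / 3)) ⊆
        (fun p => L' p + s₂) '' barlowStacking 1 (Real.sqrt (2 / 3)) σ')
    {ν : EuclideanSpace ℝ (Fin 3)} (hν : ν ≠ 0)
    {b : EuclideanSpace ℝ (Fin 3)} (hb : b ∈ (fun p => A₂ p + t₂) '' fccStacking 1 (Real.sqrt (2 / 3)))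
    (hup : ∀ w ∈ fccSlots, 0 < ⟪A₁ w, ν⟫_ℝ →
      b + A₁ w ∈ (fun p => A₂ p + t₂) '' fccStacking 1 (Real.sqrt (2 / 3))) : False :=
  hnc (coaxial_of_image_eq A₁ A₂ t₁ t₂ (linear_eq_of_upSlots_on_affine A₁ A₂ t₂ hν hb hup))

/-- **Any frame along the chain is pinned to `A₂` inside the foreign plate.**  Frame-general form for
the lines floor (frames change across twin steps): if a ball `b ∈ A₂·Λ₀ + t₂` has all its up-slots for
the frame `F` on `A₂·Λ₀ + t₂`, then `F·Λ₀ = A₂·Λ₀` (so `F` is co-axial with `A₂`; the lines floor then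
needs `F` to stay in the twin-chain class of `A₁`). -/
theorem frame_eq_foreign_of_covered
    (F A₂ : EuclideanSpace ℝ (Fin 3) ≃ₗᵢ[ℝ] EuclideanSpace ℝ (Fin 3)) (t t₂ : EuclideanSpace ℝ (Fin 3))
    {ν : EuclideanSpace ℝ (Fin 3)} (hν : ν ≠ 0)
    {b : EuclideanSpace ℝ (Fin 3)} (hb : b ∈ (fun p => A₂ p + t₂) '' fccStacking 1 (Real.sqrt (2 / 3)))
    (hup : ∀ w ∈ fccSlots, 0 < ⟪F w, ν⟫_ℝ → b + F w ∈ (fun p => A₂ p + t₂) '' fccStacking 1 (Real.sqrt (2 / 3))) :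
    ∃ (L' : EuclideanSpace ℝ (Fin 3) ≃ₗᵢ[ℝ] EuclideanSpace ℝ (Fin 3))
      (s₁ s₂ : EuclideanSpace ℝ (Fin 3)) (σ σ' : ℤ → ℤ), IsHaggSeq σ ∧ IsHaggSeq σ' ∧
      (fun p => F p + t) '' fccStacking 1 (Real.sqrt (2 / 3)) ⊆
        (fun p => L' p + s₁) '' barlowStacking 1 (Real.sqrt (2 / 3)) σ ∧
      (fun p => A₂ p + t₂) '' fccStacking 1 (Real.sqrt (2 / 3)) ⊆
        (fun p => L' p + s₂) '' barlowStacking 1 (Real.sqrt (2 / 3)) σ' :=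
  coaxial_of_image_eq F A₂ t t₂ (linear_eq_of_upSlots_on_affine F A₂ t₂ hν hb hup)

end Summit.Ventures.Crystal3D.Theorems

end
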